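import Literature.AlgebraicGeometry.Motives.CellularPeeling
import HarnessLib

/-!
# Lines on the smooth quadric surface `x₀x₃ = x₁x₂`: `CH₁` is generated by the two rulings

Tian–Zong's theorem `TianZong2014_chowOne_generatedByLines` (Compositio Math. 150 (2014), Thm. 1.7)
in the first non-linear case `n = 2`, `c = 1`, `d = 2`: a smooth quadric surface `Q ⊆ ℙ³`. In the
normal form `Q₀ = V₊(x₀x₃ - x₁x₂)` the cellular decomposition of Fulton, *Intersection Theory*,
Example 1.9.1 is explicit: `Q₀ ∩ D₊(x₀) ≅ 𝔸²` (the graph `x₃/x₀ = (x₁/x₀)(x₂/x₀)`), and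
`Q₀ ∩ V₊(x₀) = V₊(x₀, x₁) ∪ V₊(x₀, x₂)` is the union of two lines (one from each ruling). Hence, by
`A₁(𝔸²) = 0` (`Motives/AffineSpaceChow`) and the localisation sequence, every `1`-cycle on `Q₀`
is rationally equivalent to `a • [V₊(x₀,x₁)] + b • [V₊(x₀,x₂)]` (Hartshorne II 6.6.1:
`Cl Q = ℤ ⊕ ℤ`, generated by the rulings — here only the generation).

* `stdQuadric k = x₀x₃ - x₁x₂`; `graphHom`, `graphι` — the closed immersion `𝔸² ↪ 𝔸³` onto
  `V(y₂ - y₀y₁)` and `ker_graphHom`;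
* (cells in general — `exists_iso_preimage_basicOpen_of_preimage_eq`,
  `chartι_preimage_zeroLocus_of_mem` — are in `Motives/CellularPeeling`);
* `exists_isRationallyEquivalent_of_range_eq_stdQuadric` — for an integral `Y` closed-immersed
  onto `Q₀`, every `1`-cycle is rationally equivalent on `Y` to `a • [z₁] + b • [z₂]`, `zₐ` the
  points over the generic points of the two lines;
* `chowOneGeneratedByLines_of_projectivelyEquivalent_stdQuadric` — for `X` smooth projective
  embedded onto `V₊(F) ⊆ ℙ³` with `F` projectively equivalent to `x₀x₃ - x₁x₂` (an invertible
  linear substitution `τ` with `σ_τ(x₀x₃ - x₁x₂) = F`), `CH₁(X)` is generated by lines.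

Everything is proved; no named facts. The normal form of a nonsingular quadratic form over an
algebraically closed field of characteristic `≠ 2` (supplying `τ`) is not in this file.

## References

* [TianZong2014] Z. Tian, H. R. Zong, *One-cycles on rationally connected varieties*, Thm. 1.7.
* W. Fulton, *Intersection Theory*, Example 1.9.1. [Fulton1998]
* R. Hartshorne, *Algebraic Geometry*, II Example 6.6.1, I Ex. 2.15. [Hartshorne1977]
-/

noncomputable section

open CategoryTheory AlgebraicGeometry Order TopologicalSpace

universe u

namespace Literature.AlgebraicGeometry.Motives

namespace ProjectiveSpaceCells

/-! ### The standard quadric surface `x₀x₃ = x₁x₂` and its affine cell -/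

section StdQuadric

open _root_.MvPolynomial

variable (k : Type u) [Field k]

attribute [local instance] MvPolynomial.gradedAlgebra ProjBaseChange.algebraBase

local notation "𝓐" => MvPolynomial.homogeneousSubmodule (Fin (3 + 1)) k

/-- **The standard smooth quadric form `x₀x₃ - x₁x₂`** on `ℙ³`. [cite: Hartshorne1977, I Ex. 2.15] -/
def stdQuadric : MvPolynomial (Fin (3 + 1)) k :=
  MvPolynomial.X 0 * MvPolynomial.X 3 - MvPolynomial.X 1 * MvPolynomial.X 2

/-- `x₀x₃ - x₁x₂` is a quadratic form. [folklore] -/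
theorem isHomogeneous_stdQuadric : (stdQuadric k).IsHomogeneous 2 :=
  ((MvPolynomial.isHomogeneous_X k 0).mul (MvPolynomial.isHomogeneous_X k 3)).sub
    ((MvPolynomial.isHomogeneous_X k 1).mul (MvPolynomial.isHomogeneous_X k 2))

/-- `x₀x₃ - x₁x₂ ∈ 𝓐₂`. [folklore] -/
theorem stdQuadric_mem : stdQuadric k ∈ 𝓐 2 :=
  (MvPolynomial.mem_homogeneousSubmodule 2 _).mpr (isHomogeneous_stdQuadric k)

/-- The dehomogenised quadric `y₂ - y₀y₁` (`yⱼ = x_{j+1}/x₀`). [folklore] -/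
def stdQuadricChart : MvPolynomial (Fin 3) k :=
  MvPolynomial.X 2 - MvPolynomial.X 0 * MvPolynomial.X 1

/-- Dehomogenising `x₀x₃ - x₁x₂` at `x₀` gives `y₂ - y₀y₁`. [folklore] -/
theorem dehomogenize_stdQuadric :
    ProjectiveSpace.dehomogenize k (0 : Fin (3 + 1)) (stdQuadric k) = stdQuadricChart k := by
  simp only [stdQuadric, stdQuadricChart, map_sub, map_mul, ProjectiveSpace.dehomogenize_X_self,
    one_mul]
  rw [show (3 : Fin (3 + 1)) = (0 : Fin (3 + 1)).succAbove 2 from rfl,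
    show (1 : Fin (3 + 1)) = (0 : Fin (3 + 1)).succAbove 0 from rfl,
    show (2 : Fin (3 + 1)) = (0 : Fin (3 + 1)).succAbove 1 from rfl,
    ProjectiveSpace.dehomogenize_X_succAbove, ProjectiveSpace.dehomogenize_X_succAbove,
    ProjectiveSpace.dehomogenize_X_succAbove]

/-- **`Q₀ ∩ D₊(x₀)` in the chart is `V(y₂ - y₀y₁)`.** [folklore] -/
theorem chartι_zero_preimage_zeroLocus_stdQuadric :
    (chartι k 3 0).base ⁻¹' ProjectiveSpectrum.zeroLocus 𝓐 {stdQuadric k} =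
      PrimeSpectrum.zeroLocus {stdQuadricChart k} := by
  rw [chartι_preimage_zeroLocus_of_mem k 0 two_pos (stdQuadric_mem k), dehomogenize_stdQuadric]

/-- **The graph map `k[y₀, y₁, y₂] → k[s, t]`, `y₀ ↦ s`, `y₁ ↦ t`, `y₂ ↦ st`.** [folklore] -/
def graphHom : MvPolynomial (Fin 3) k →ₐ[k] MvPolynomial (Fin 2) k :=
  MvPolynomial.aeval ![MvPolynomial.X 0, MvPolynomial.X 1, MvPolynomial.X 0 * MvPolynomial.X 1]

/-- The section `k[s, t] → k[y₀, y₁, y₂]`, `s ↦ y₀`, `t ↦ y₁`. [folklore] -/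
def graphSection : MvPolynomial (Fin 2) k →ₐ[k] MvPolynomial (Fin 3) k :=
  MvPolynomial.aeval ![MvPolynomial.X 0, MvPolynomial.X 1]

/-- `graphHom ∘ graphSection = id`. [folklore] -/
theorem graphHom_comp_graphSection : (graphHom k).comp (graphSection k) = AlgHom.id k _ := by
  refine MvPolynomial.algHom_ext fun j ↦ ?_
  fin_cases j <;> simp [graphHom, graphSection]

/-- `graphHom` is surjective. [folklore] -/
theorem graphHom_surjective : Function.Surjective (graphHom k) := fun p ↦
  ⟨graphSection k p, congr($(graphHom_comp_graphSection k) p)⟩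

/-- `graphHom (y₂ - y₀y₁) = 0`. [folklore] -/
theorem graphHom_stdQuadricChart : graphHom k (stdQuadricChart k) = 0 := by
  simp [graphHom, stdQuadricChart]

/-- `graphSection (graphHom yⱼ) ≡ yⱼ (mod y₂ - y₀y₁)`. [folklore] -/
theorem graphSection_graphHom_X_sub_mem (j : Fin 3) :
    graphSection k (graphHom k (MvPolynomial.X j)) - MvPolynomial.X j ∈
      Ideal.span {stdQuadricChart k} := by
  fin_cases j
  · simp [graphHom, graphSection]
  · simp [graphHom, graphSection]
  · have h : graphSection k (graphHom k (MvPolynomial.X 2)) - MvPolynomial.X 2 =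
        -stdQuadricChart k := by
      simp [graphHom, graphSection, stdQuadricChart]
    simp only [Fin.reduceFinMk, Fin.isValue]
    rw [h]
    exact (Ideal.neg_mem_iff _).mpr (Ideal.subset_span rfl)

/-- **`ker (y₀ ↦ s, y₁ ↦ t, y₂ ↦ st) = (y₂ - y₀y₁)`.** [folklore] -/
theorem ker_graphHom : RingHom.ker (graphHom k) = Ideal.span {stdQuadricChart k} := by
  apply le_antisymm
  · intro p hp
    rw [RingHom.mem_ker] at hp
    -- modulo `(y₂ - y₀y₁)`, every polynomial agrees with `graphSection (graphHom p)`
    have hπ : (Ideal.Quotient.mkₐ k (Ideal.span {stdQuadricChart k})).comp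
        ((graphSection k).comp (graphHom k)) =
          Ideal.Quotient.mkₐ k (Ideal.span {stdQuadricChart k}) := by
      refine MvPolynomial.algHom_ext fun j ↦ ?_
      simp only [AlgHom.coe_comp, Function.comp_apply, Ideal.Quotient.mkₐ_eq_mk]
      exact Ideal.Quotient.eq.mpr (graphSection_graphHom_X_sub_mem k j)
    have h := congr($hπ p)
    simp only [AlgHom.coe_comp, Function.comp_apply, Ideal.Quotient.mkₐ_eq_mk, hp, map_zero] at h
    exact Ideal.Quotient.eq_zero_iff_mem.mp h.symm
  · rw [Ideal.span_le, Set.singleton_subset_iff]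
    exact graphHom_stdQuadricChart k

/-- **The closed immersion `𝔸² ↪ 𝔸³` onto the graph `y₂ = y₀y₁`.** [folklore] -/
def graphι : Spec (CommRingCat.of (MvPolynomial (Fin 2) k)) ⟶
    Spec (CommRingCat.of (MvPolynomial (Fin 3) k)) :=
  Spec.map (CommRingCat.ofHom (graphHom k).toRingHom)

/-- `graphι` is a closed immersion. [folklore] -/
instance isClosedImmersion_graphι : IsClosedImmersion (graphι k) :=
  IsClosedImmersion.spec_of_surjective _ (graphHom_surjective k)

/-- The image of `graphι` is `V(y₂ - y₀y₁)`. [folklore] -/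
theorem range_graphι : Set.range (graphι k).base = PrimeSpectrum.zeroLocus {stdQuadricChart k} := by
  change Set.range (PrimeSpectrum.comap (graphHom k).toRingHom) = _
  rw [range_comap_of_surjective _ _ (graphHom_surjective k)]
  change PrimeSpectrum.zeroLocus ((RingHom.ker (graphHom k) : Ideal (MvPolynomial (Fin 3) k)) :
    Set (MvPolynomial (Fin 3) k)) = _
  rw [ker_graphHom k, PrimeSpectrum.zeroLocus_span]

/-- **`Q₀ ∩ D₊(x₀) ≅ 𝔸²`**: for a closed immersion `e : Y ↪ ℙ³` from a reduced scheme with image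
`Q₀ = V₊(x₀x₃ - x₁x₂)`, the open part of `Y` over `D₊(x₀)` is `Spec k[s, t]`.
[cite: Fulton1998, Example 1.9.1] -/
theorem exists_iso_preimage_basicOpen_stdQuadric {Y : Scheme.{u}} [IsReduced Y]
    (e : Y ⟶ Proj 𝓐) [IsClosedImmersion e]
    (hrange : Set.range e.base = ProjectiveSpectrum.zeroLocus 𝓐 {stdQuadric k}) :
    Nonempty (↑(e ⁻¹ᵁ Proj.basicOpen 𝓐 (MvPolynomial.X 0)) ≅
      Spec (CommRingCat.of (MvPolynomial (Fin 2) k))) :=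
  exists_iso_preimage_basicOpen_of_preimage_eq k e (graphι k) 0
    (by rw [hrange, chartι_zero_preimage_zeroLocus_stdQuadric, range_graphι])

/-- **`A₁(Q₀ ∩ D₊(x₀)) = 0`.** [cite: Fulton1998, §1.9 and Example 1.9.1] -/
theorem cyclesOfDim_one_preimage_basicOpen_stdQuadric_le {Y : Scheme.{u}} [IsReduced Y]
    (e : Y ⟶ Proj 𝓐) [IsClosedImmersion e]
    (hrange : Set.range e.base = ProjectiveSpectrum.zeroLocus 𝓐 {stdQuadric k}) :
    cyclesOfDim (↑(e ⁻¹ᵁ Proj.basicOpen 𝓐 (MvPolynomial.X 0)) : Scheme.{u}) 1 ≤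
      ratTrivial (↑(e ⁻¹ᵁ Proj.basicOpen 𝓐 (MvPolynomial.X 0)) : Scheme.{u}) 1 := by
  obtain ⟨ε⟩ := exists_iso_preimage_basicOpen_stdQuadric k e hrange
  exact cyclesOfDim_le_ratTrivial_of_iso ε
    (AffineLineProduct.cyclesOfDim_spec_le_ratTrivial k one_lt_two)

/-! ### The two lines `V₊(x₀, x₁)`, `V₊(x₀, x₂)` at infinity -/

/-- `![x, y]` is injective for `x ≠ y`. [folklore] -/
theorem injective_vecCons_pair {α : Type*} {x y : α} (h : x ≠ y) : Function.Injective ![x, y] := by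
  intro i j hij
  fin_cases i <;> fin_cases j
  · rfl
  · exact absurd hij (by simpa using h)
  · exact absurd hij (by simpa using h.symm)
  · rfl

/-- The linear forms `x₀, xₐ`. [folklore] -/
def rulingForms (a : Fin (3 + 1)) : Fin 2 → MvPolynomial (Fin (3 + 1)) k := ![MvPolynomial.X 0, MvPolynomial.X a]

variable {a : Fin (3 + 1)}

/-- `x₀, xₐ` are linearly independent for `a ≠ 0`. [folklore] -/
theorem linearIndependent_rulingForms (ha : a ≠ 0) : LinearIndependent k (rulingForms k a) := by
  have h : rulingForms k a = (fun j ↦ MvPolynomial.X j) ∘ ![(0 : Fin (3 + 1)), a] := by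
    ext j : 1; fin_cases j <;> rfl
  rw [h]
  exact (MvPolynomial.linearIndependent_X (Fin (3 + 1)) k).comp _ (injective_vecCons_pair ha.symm)

/-- `x₀, xₐ` are linear. [folklore] -/
theorem isHomogeneous_rulingForms (j : Fin 2) : (rulingForms k a j).IsHomogeneous 1 := by
  fin_cases j <;> exact MvPolynomial.isHomogeneous_X k _

/-- **The generic point of the line `V₊(x₀, xₐ)` of `Q₀`** (`a = 1, 2`: one line of each ruling
through `[0:0:0:1]`). [cite: Hartshorne1977, I Ex. 2.15] -/
def rulingPoint (ha : a ≠ 0) : ↥(Proj 𝓐) :=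
  linearSubspacePoint (rulingForms k a) (linearIndependent_rulingForms k ha)
    (isHomogeneous_rulingForms k) (by norm_num)

/-- `closure {rulingPoint} = V₊(x₀, xₐ)`. [folklore] -/
theorem closure_rulingPoint (ha : a ≠ 0) :
    closure {rulingPoint k ha} = ProjectiveSpectrum.zeroLocus 𝓐 (Set.range (rulingForms k a)) :=
  closure_linearSubspacePoint _ _ _ _

/-- The ruling lines have dimension `1`. [folklore] -/
theorem height_rulingPoint (ha : a ≠ 0) : height (rulingPoint k ha) = 1 := by
  have h := height_linearSubspacePoint (rulingForms k a) (linearIndependent_rulingForms k ha)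
    (isHomogeneous_rulingForms k) (by norm_num)
  exact h

/-- The homogeneous ideal of `rulingPoint` is `(x₀, xₐ)`. [folklore] -/
theorem toIdeal_rulingPoint (ha : a ≠ 0) :
    (ProjectiveSpectrum.asHomogeneousIdeal (𝒜 := 𝓐) (rulingPoint k ha)).toIdeal =
      Ideal.span (Set.range (rulingForms k a)) :=
  toIdeal_linearSubspacePoint _ _ _ _

/-- The lines `V₊(x₀, xₐ)` lie on `Q₀` (`x₀x₃ - x₁x₂ ∈ (x₀, xₐ)` for `a = 1, 2`). [folklore] -/
theorem rulingPoint_mem_zeroLocus_stdQuadric (ha : a ≠ 0) (ha' : a = 1 ∨ a = 2) :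
    rulingPoint k ha ∈ ProjectiveSpectrum.zeroLocus 𝓐 {stdQuadric k} := by
  change {stdQuadric k} ⊆
    ((ProjectiveSpectrum.asHomogeneousIdeal (𝒜 := 𝓐) (rulingPoint k ha)).toIdeal : Set _)
  rw [Set.singleton_subset_iff, SetLike.mem_coe, toIdeal_rulingPoint, stdQuadric]
  refine Ideal.sub_mem _ (Ideal.mul_mem_right _ _ (Ideal.subset_span ⟨0, rfl⟩)) ?_
  rcases ha' with rfl | rfl
  · exact Ideal.mul_mem_right _ _ (Ideal.subset_span ⟨1, rfl⟩)
  · exact Ideal.mul_mem_left _ _ (Ideal.subset_span ⟨1, rfl⟩)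

/-- A point of `V₊(x₀, xₐ)` of dimension `1` is the generic point. [folklore] -/
theorem eq_rulingPoint_of_height_eq (ha : a ≠ 0) {z : ↥(Proj 𝓐)}
    (hz : z ∈ ProjectiveSpectrum.zeroLocus 𝓐 (Set.range (rulingForms k a))) (hh : height z = 1) :
    z = rulingPoint k ha := by
  by_contra hne
  have h := height_lt_of_mem_zeroLocus (rulingForms k a) (linearIndependent_rulingForms k ha)
    (isHomogeneous_rulingForms k) (by norm_num) (z := z) hz hne
  have h' : height z < 1 := h
  exact (lt_irrefl _) (hh ▸ h')

/-- The two ruling lines are different. [folklore] -/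
theorem rulingPoint_one_ne_two :
    rulingPoint k (a := 1) one_ne_zero ≠ rulingPoint k (a := 2) two_ne_zero := by
  intro h
  have h1 : (MvPolynomial.X 1 : MvPolynomial (Fin (3 + 1)) k) ∈
      Ideal.span (Set.range (rulingForms k 2)) := by
    rw [← toIdeal_rulingPoint k two_ne_zero, ← h, toIdeal_rulingPoint]
    exact Ideal.subset_span ⟨1, rfl⟩
  have hset : Set.range (rulingForms k (2 : Fin (3 + 1))) =
      (fun j ↦ (MvPolynomial.X j : MvPolynomial (Fin (3 + 1)) k)) '' {0, 2} := by
    ext f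
    simp only [rulingForms, Set.mem_range, Set.mem_image, Set.mem_insert_iff, Set.mem_singleton_iff]
    constructor
    · rintro ⟨j, rfl⟩; fin_cases j
      · exact ⟨0, Or.inl rfl, rfl⟩
      · exact ⟨2, Or.inr rfl, rfl⟩
    · rintro ⟨j, rfl | rfl, rfl⟩
      · exact ⟨0, rfl⟩
      · exact ⟨1, rfl⟩
  rw [hset, Literature.RingTheory.MvPolynomial.X_mem_span_X_image_iff] at h1
  simp only [Set.mem_insert_iff, Set.mem_singleton_iff] at h1
  rcases h1 with h | h <;> exact absurd h (by decide)

/-- **`Q₀ ∖ D₊(x₀)` is the union of the two lines**: a point of `Q₀` with `x₀ = 0` lies on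
`V₊(x₀, x₁)` or on `V₊(x₀, x₂)`. [cite: Hartshorne1977, I Ex. 2.15] -/
theorem mem_zeroLocus_rulingForms_of_notMem_basicOpen {z : ↥(Proj 𝓐)}
    (hz : z ∈ ProjectiveSpectrum.zeroLocus 𝓐 {stdQuadric k})
    (hx : z ∉ Proj.basicOpen 𝓐 (MvPolynomial.X 0)) :
    z ∈ ProjectiveSpectrum.zeroLocus 𝓐 (Set.range (rulingForms k 1)) ∨
      z ∈ ProjectiveSpectrum.zeroLocus 𝓐 (Set.range (rulingForms k 2)) := by
  set P : ProjectiveSpectrum 𝓐 := z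
  have hx0 : (MvPolynomial.X 0 : MvPolynomial (Fin (3 + 1)) k) ∈ P.asHomogeneousIdeal := by
    by_contra h; exact hx h
  have hq : stdQuadric k ∈ P.asHomogeneousIdeal := hz rfl
  have h12 : (MvPolynomial.X 1 * MvPolynomial.X 2 : MvPolynomial (Fin (3 + 1)) k) ∈
      P.asHomogeneousIdeal := by
    have h : MvPolynomial.X 0 * MvPolynomial.X 3 - stdQuadric k ∈ P.asHomogeneousIdeal :=
      Ideal.sub_mem _ (Ideal.mul_mem_right _ _ hx0) hq
    simpa [stdQuadric] using h
  rcases P.isPrime.mem_or_mem h12 with h1 | h2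
  · left
    rintro f ⟨j, rfl⟩
    fin_cases j
    · exact hx0
    · exact h1
  · right
    rintro f ⟨j, rfl⟩
    fin_cases j
    · exact hx0
    · exact h2

/-! ### `CH₁(Q₀)` is generated by the two rulings -/

/-- **Every `1`-cycle on the quadric surface `Q₀` is rationally equivalent to an integral
combination of the two lines `V₊(x₀, x₁)`, `V₊(x₀, x₂)`** (for any integral scheme `Y`
closed-immersed onto `Q₀`; Fulton Example 1.9.1 with the cell `Q₀ ∩ D₊(x₀) ≅ 𝔸²`, `A₁(𝔸²) = 0`,
and the localisation sequence). [cite: Fulton1998, Example 1.9.1] [cite: Hartshorne1977, II Example 6.6.1] -/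
theorem exists_isRationallyEquivalent_of_range_eq_stdQuadric {Y : Scheme.{u}} [IsIntegral Y]
    (e : Y ⟶ Proj 𝓐) [IsClosedImmersion e]
    (hrange : Set.range e.base = ProjectiveSpectrum.zeroLocus 𝓐 {stdQuadric k})
    (c : AlgebraicCycle Y ℤ) (hc : c ∈ cyclesOfDim Y 1) :
    ∃ (z₁ z₂ : Y) (a b : ℤ), e.base z₁ = rulingPoint k (a := 1) one_ne_zero ∧
      e.base z₂ = rulingPoint k (a := 2) two_ne_zero ∧ z₁ ≠ z₂ ∧
        IsRationallyEquivalent c (a • primeCycle z₁ + b • primeCycle z₂) 1 := by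
  haveI : IsProper (projectiveSpace 3 k).hom := isProper_projectiveSpace 3 k
  let e' : Y ⟶ (projectiveSpace 3 k).left := e
  haveI : IsClosedImmersion e' := ‹IsClosedImmersion e›
  let f : Y ⟶ Spec (CommRingCat.of k) := e' ≫ (projectiveSpace 3 k).hom
  haveI hf₁ : LocallyOfFiniteType f := inferInstance
  haveI hf₂ : QuasiCompact f := inferInstance
  let YO : SchemeOver k := Over.mk f
  haveI : LocallyOfFiniteType YO.hom := hf₁
  haveI : QuasiCompact YO.hom := hf₂
  -- the cell
  let U : Y.Opens := e ⁻¹ᵁ Proj.basicOpen 𝓐 (MvPolynomial.X 0)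
  have hU := cyclesOfDim_one_preimage_basicOpen_stdQuadric_le k e hrange
  have hres : flatPullback U.ι locallyFinsupp_flatPullbackFun_holds c ∈
      ratTrivial (U : Scheme.{u}) 1 := by
    refine hU (fun u hu ↦ ?_)
    rw [flatPullback_ι_apply] at hu
    calc height u = height (U.ι.base u) := (height_opens_ι_base YO U u).symm
      _ = _ := hc _ hu
  obtain ⟨c', hc', hsupp, hcc'⟩ : ∃ c' ∈ cyclesOfDim Y 1, (∀ z : Y, c' z ≠ 0 → z ∉ U) ∧
      IsRationallyEquivalent c c' 1 :=
    Fulton1998_localizationSequence_holds YO U locallyFinsupp_flatPullbackFun_holds 1 c hc hres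
  -- the two points over the ruling lines
  obtain ⟨z₁, hz₁⟩ : ∃ z₁, e.base z₁ = rulingPoint k (a := 1) one_ne_zero := by
    have h : rulingPoint k (a := 1) one_ne_zero ∈ Set.range e.base := by
      rw [hrange]; exact rulingPoint_mem_zeroLocus_stdQuadric k one_ne_zero (Or.inl rfl)
    exact h
  obtain ⟨z₂, hz₂⟩ : ∃ z₂, e.base z₂ = rulingPoint k (a := 2) two_ne_zero := by
    have h : rulingPoint k (a := 2) two_ne_zero ∈ Set.range e.base := by
      rw [hrange]; exact rulingPoint_mem_zeroLocus_stdQuadric k two_ne_zero (Or.inr rfl)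
    exact h
  have hne : z₁ ≠ z₂ := fun h ↦ rulingPoint_one_ne_two k (by rw [← hz₁, ← hz₂, h])
  -- `c'` is supported on `{z₁, z₂}`
  have hc'z : ∀ z, c' z ≠ 0 → z = z₁ ∨ z = z₂ := by
    intro z hz
    have hh : height (e.base z) = 1 := by
      rw [height_base_eq_of_isClosedImmersion' e z]; exact_mod_cast hc' z hz
    have hmem : e.base z ∈ ProjectiveSpectrum.zeroLocus 𝓐 {stdQuadric k} := hrange ▸ ⟨z, rfl⟩
    rcases mem_zeroLocus_rulingForms_of_notMem_basicOpen k hmem (hsupp z hz) with h | h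
    · left
      exact e.isClosedEmbedding.injective ((eq_rulingPoint_of_height_eq k one_ne_zero h hh).trans
        hz₁.symm)
    · right
      exact e.isClosedEmbedding.injective ((eq_rulingPoint_of_height_eq k two_ne_zero h hh).trans
        hz₂.symm)
  have hc'eq : c' = c' z₁ • primeCycle z₁ + c' z₂ • primeCycle z₂ := by
    classical
    have hs : Function.support c' ⊆ (({z₁, z₂} : Finset Y) : Set Y) := fun z hz ↦ by
      rcases hc'z z hz with rfl | rfl <;> simp
    rw [← Finset.sum_pair (f := fun z ↦ c' z • primeCycle z) hne]
    exact eq_sum_smul_primeCycle_of_support_subset c' hs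
  exact ⟨z₁, z₂, c' z₁, c' z₂, hz₁, hz₂, hne, hc'eq ▸ hcc'⟩

end StdQuadric

/-! ### Tian–Zong for a quadric surface projectively equivalent to `x₀x₃ = x₁x₂` -/

section QuadricSurface

open _root_.MvPolynomial

variable {k : Type u} [Field k]

attribute [local instance] MvPolynomial.gradedAlgebra ProjBaseChange.algebraBase

/-- **`CH₁` of a smooth quadric surface projectively equivalent to `x₀x₃ = x₁x₂` is generated by
lines.** Let `X` be a smooth projective `k`-surface, `i : X ⟶ ℙ³_k` a closed `k`-immersion with
image `V₊(F)`, and `τ` an invertible linear substitution with `σ_τ(x₀x₃ - x₁x₂) = F`. Then every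
`1`-cycle on `X` is rationally equivalent to an integral combination of lines of `X` (the two
rulings through a point). [cite: TianZong2014, Thm. 1.7 (quadric surfaces)]
[cite: Hartshorne1977, II Example 6.6.1] -/
theorem chowOneGeneratedByLines_of_projectivelyEquivalent_stdQuadric {X : SchemeOver k}
    (F : MvPolynomial (Fin (2 + 1 + 1)) k) (i : X ⟶ projectiveSpace (2 + 1) k)
    (hX : IsSmoothProjective 2 X) (hi : IsClosedImmersion i.left)
    (hV : Set.range i.left.base =
      ProjectiveSpectrum.zeroLocus (MvPolynomial.homogeneousSubmodule (Fin (2 + 1 + 1)) k) {F})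
    (τ τ' : Fin (2 + 1 + 1) → MvPolynomial (Fin (2 + 1 + 1)) k)
    (hτ : ∀ j, (τ j).IsHomogeneous 1) (hτ' : ∀ j, (τ' j).IsHomogeneous 1)
    (hinv : ∀ p, MvPolynomial.aeval τ (MvPolynomial.aeval τ' p) = p)
    (hinv' : ∀ p, MvPolynomial.aeval τ' (MvPolynomial.aeval τ p) = p)
    (hτli : LinearIndependent k τ) (hF : MvPolynomial.aeval τ (stdQuadric k) = F) :
    ChowOneGeneratedByLines (2 + 1) i := by
  classical
  haveI : CompactSpace ↥X.left := IsSmoothProjective.compactSpace_holds hX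
  haveI : IsIntegral X.left := IsSmoothProjective.isIntegral_holds hX
  let σ := ProjectiveSpace.substMapHom τ hτ τ' hτ' hinv
  haveI : IsIso σ := isIso_substMapHom τ hτ τ' hτ' hinv hinv'
  let i' : X.left ⟶ Proj (MvPolynomial.homogeneousSubmodule (Fin (2 + 1 + 1)) k) := i.left
  haveI : IsClosedImmersion i' := hi
  let e := i' ≫ σ
  have hpre : σ.base ⁻¹' ProjectiveSpectrum.zeroLocus _ {stdQuadric k} = Set.range i'.base := by
    change _ = Set.range i.left.base
    rw [substMapHom_preimage_zeroLocus, hV, Set.image_singleton, hF]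
  have hrange : Set.range e.base = ProjectiveSpectrum.zeroLocus _ {stdQuadric k} := by
    rw [Scheme.Hom.comp_base, TopCat.coe_comp, Set.range_comp, ← hpre]
    exact Set.image_preimage_eq _ σ.homeomorph.surjective
  -- line points: the points over the rulings
  have hline : ∀ {a : Fin (3 + 1)} (ha : a ≠ 0) {y : ↥X.left}, e.base y = rulingPoint k ha →
      IsLinePoint (2 + 1) i y := by
    intro a ha y hy
    refine ⟨?_, fun j ↦ MvPolynomial.aeval τ (rulingForms k a j), ?_, fun j ↦ ?_, ?_⟩
    · rw [← height_base_eq_of_isClosedImmersion' e y, hy]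
      exact height_rulingPoint k ha
    · have hL : (fun j ↦ MvPolynomial.aeval τ (rulingForms k a j)) = τ ∘ ![(0 : Fin (3 + 1)), a] := by
        funext j; fin_cases j <;> simp [rulingForms]
      rw [hL]
      exact hτli.comp _ (injective_vecCons_pair ha.symm)
    · exact (isHomogeneous_rulingForms k j).aeval τ hτ
    · have himg : ⇑i.left.base '' closure {y} = σ.base ⁻¹' (e.base '' closure {y}) := by
        rw [Scheme.Hom.comp_base, TopCat.coe_comp, Set.image_comp]
        exact (Set.preimage_image_eq _ σ.isClosedEmbedding.injective).symm
      rw [himg, ← e.isClosedEmbedding.closure_image_eq, Set.image_singleton, hy,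
        closure_rulingPoint, substMapHom_preimage_zeroLocus, ← Set.range_comp]
      rfl
  refine (chowOneGeneratedByLines_iff_forall_primeCycle (N := 2 + 1) (i := i)).mpr fun z hz ↦ ?_
  obtain ⟨z₁, z₂, a, b, hz₁, hz₂, hne, hrat⟩ := exists_isRationallyEquivalent_of_range_eq_stdQuadric
    k e hrange (primeCycle z) (primeCycle_mem_cyclesOfDim (by simpa using hz))
  refine ⟨{z₁, z₂}, fun y ↦ if y = z₁ then a else b, fun y hy ↦ ?_, ?_⟩
  · rw [Finset.mem_insert, Finset.mem_singleton] at hy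
    rcases hy with rfl | rfl
    · exact hline one_ne_zero hz₁
    · exact hline two_ne_zero hz₂
  · rw [Finset.sum_pair hne]
    simpa [hne.symm] using hrat

end QuadricSurface

end ProjectiveSpaceCells

end Literature.AlgebraicGeometry.Motives
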